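import Mathlib.MeasureTheory.Integral.Bochner.Basic
import Mathlib.MeasureTheory.Measure.Dirac
import HarnessLib

/-!
# No stiffness (Drude / helicity-modulus) FLOOR from finitely many moment windows: the inverse current
# moment is invisible to every finite list of power moments of non-zero width

HONEST FRAMING: one-sided certified stiffness CEILINGS are what the cell produces; this file is the formal version of the
standing rule «no FLOOR on the superfluid stiffness is obtainable from positivity + an energy window» (HOME/hubbard-obs-p2/
STIFFNESS-SDP.md §4, TARGET.md verdict line; the stiffness twin of `Observables/BraggWeightNoFloor.lean`). Pure measure
theory; zero compute; NO definition, no named fact, no `sorry`. Cell hubbard-obs (D-0042 crew 1), seat hubbard-obs-p2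
(STIFFNESS), gen 5. Not a superconductivity verdict — it says nothing about the size of `ρ_s`; it says which SENTENCES the
instrument can write.

DICTIONARY (Kohn 1964; Scalapino–White–Zhang 1993 §II; Lipparini 2008 eqs. (8.30)–(8.33)). On the `L × L` torus with uniform
twist `u = θ/L` on every `e₁`-bond the Hamiltonian is the trigonometric form `H(u) = H + (1 − cos u)𝒦 + sin u·𝒥` (tree:
`re_star_dotProduct_uniformTwistTT'_mulVec_eq_kin_cur`), `𝒦 = kinOpTT'`, `𝒥 = curOpTT'`. For a non-degenerate sector ground
state `ψ₀` (energy `E₀`, excited sector levels `E_n > E₀`) second-order perturbation theory gives Kohn's formula for the flux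
stiffness `ρ_s` (`E(θ) − E(0) = ρ_s θ² + o(θ²)`):
  `ρ_s L² = K − M₋₁`, `K = ½ Re⟨ψ₀, 𝒦 ψ₀⟩`, `M₋₁ = Σ_{n>0} |⟨n|𝒥|ψ₀⟩|²/(E_n − E₀) = ∫ x⁻¹ dμ_𝒥(x)`,
where `μ_𝒥 = Σ_{n>0} |⟨n|𝒥|ψ₀⟩|² δ_{E_n − E₀}` is the CURRENT SPECTRAL MEASURE — a finite positive measure on `(0, ∞)`. Its
power moments `m_k = ∫ x^k dμ_𝒥` are ground-state expectations: `m₁ = ½⟨[𝒥,[H,𝒥]]⟩` (tree: `curOpTT'_firstMoment_eq_re_doubleCommutator`),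
`m₃`, … = nested commutators = translation averages of LOCAL densities (Observables/StiffnessTLOddMomentIdentification.lean),
i.e. exactly what a window SDP over local moments certifies, to a window of non-zero width; the even moments `m₀ = ⟨𝒥²⟩, m₂, …`
are `q = 0` structure factors (torus programme R-0c). CEILINGS on `ρ_s` = LOWER bounds on `M₋₁` from such moments (Jensen /
Bohigas–Lane–Martorell `M₋₁ ≥ m₀²/m₁`, odd form `M₋₁ ≥ m₁²/m₃`; tree T2/T3/R-K3-TL) — and those are all there is:

* `integral_add_pointMass` — bookkeeping: `∫ f d(μ + η δ_{x₀}) = ∫ f dμ + η f(x₀)`.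
* `exists_pointMass_moments_close_invMoment_ge` — for every finite measure `μ` on `ℝ` with `x⁻¹ ∈ L¹(μ)`, every `ε > 0` and every
  target `Λ`, the measure `ν = μ + η δ_{x₀}` with some `0 < η ≤ ε`, `0 < x₀ ≤ 1` has EVERY power moment within `ε` of `μ`'s
  (`|∫ x^k dν − ∫ x^k dμ| ≤ ε` for all `k : ℕ` at once) and `∫ x⁻¹ dν ≥ Λ`. (A sliver of spectral weight `η` at excitation energy
  `x₀ ↓ 0` costs `η x₀^k ≤ η` in every moment and buys `η/x₀ → ∞` in `M₋₁`.)
* `exists_invMoment_ge_in_strict_windows` — THE BARRIER SENTENCE: if the data are STRICT windows `lo k < m_k(μ) < hi k` on a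
  FINITE set `K` of exponents, then for every `Λ` they are also satisfied by a finite positive measure `ν ≥ μ` carried by `(0,∞)`
  whenever `μ` is (`μ(−∞,0] = 0 ⇒ ν(−∞,0] = 0`) with `∫ x⁻¹ dν ≥ Λ`; hence, for every kinetic value `K` and every `ρ₀`, the
  Kohn value `K − ∫ x⁻¹ dν` is `≤ ρ₀` on data the windows cannot tell from `μ_𝒥`'s. So NO finite family of moment windows of
  non-zero width — in particular no finite set of the cell's certified rows (kinetic, `d1U`, `m3T`, `m3U`, current structure
  factors, at any level, with any energy window) — implies a positive lower bound on the flux stiffness / Drude weight through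
  the moment (Kohn) architecture: «`ρ_s > 0`», «`D > 0`» are not sentences this instrument can write; CEILINGS are.
* `invMoment_le_mass_div_of_gap` — EVASION (i): a certified GAP `Δ > 0` below the current spectral weight (`ν[0,Δ) = 0`) caps
  `∫ x⁻¹ dν ≤ ν(ℝ)/Δ = m₀/Δ`, hence a FLOOR `ρ_s L² ≥ K − m₀/Δ`; nothing in the programme certifies such a gap at `(8, 7/8)`.
  Other evasions (not typed): frustration-free Hamiltonians, where the relaxation is exact at `θ = 0` (He et al., PRL 2026,
  arXiv:2506.18969 — inapplicable to the repulsive Hubbard model at `U = 8`), and infinitely many EXACT moments (determinacy).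
* `sq_mass_le_invMoment_mul_firstMoment`, `sq_firstMoment_le_invMoment_mul_thirdMoment` — what finitely many moments DO give
  (appendix, same seat): the Jensen / AM–GM LOWER bounds `M₋₁ ≥ m₀²/m₁` (even form, the tree's T3) and `M₋₁ ≥ m₁²/m₃`
  (odd form, the R-K3-TL row) for measures carried by `(0,∞)` — i.e. CEILINGS `ρ_s L² ≤ K − m₀²/m₁`, `K − m₁²/m₃`; via the
  elementary `sq_le_mul_of_forall_two_mul_le` (`2m ≤ ta + b/t ∀ t > 0 ⇒ m² ≤ ab`).
Complement in tree: the energy WINDOW itself is twist-blind at every `L` (`abs_fluxEnergy_sub_fluxEnergy_le`,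
HubbardTorusFluxLipschitz.lean: `|E_L(Φ) − E_L(Φ′)| ≤ 4π²|Φ − Φ′| + 4(Φ − Φ′)²` uniformly in `L ≥ 4`, so a per-site window of width `w`
constrains `E_L(θ) − E_L(0)` only when `w L² ≲ 4π²|θ|`).

References: W. Kohn, Phys. Rev. 133 (1964) A171, §II [Kohn1964]; D. J. Scalapino, S. R. White, S. C. Zhang, PRB 47 (1993) 7995, §II
[ScalapinoWhiteZhang1993]; E. Lipparini, *Modern Many-Particle Physics* (2008), §8.4 eqs. (8.30)–(8.33) [Lipparini2008]; the moment-space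
fact itself is folklore (Shohat–Tamarkin, *The Problem of Moments* (1943), Ch. II).
-/

noncomputable section

open MeasureTheory Filter Set
open scoped ENNReal BigOperators

namespace Summit.Ventures.CertifiedManyBodySolver.Observables

/-! ### Adding a point mass -/

/-- Bookkeeping: `∫ f d(μ + η δ_{x₀}) = ∫ f dμ + η·f(x₀)` for `f ∈ L¹(μ)`, `η ≥ 0`. [folklore] -/
theorem integral_add_pointMass (μ : Measure ℝ) {f : ℝ → ℝ} (hf : Integrable f μ) {η : ℝ} (hη : 0 ≤ η)
    (x₀ : ℝ) :
    ∫ x, f x ∂(μ + (Real.toNNReal η) • Measure.dirac x₀) = (∫ x, f x ∂μ) + η * f x₀ := by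
  rw [integral_add_measure hf ((integrable_dirac (by simp)).smul_measure_nnreal),
    integral_smul_nnreal_measure, integral_dirac, NNReal.smul_def, Real.coe_toNNReal η hη, smul_eq_mul]

/-- The perturbed measure is finite. [folklore] -/
theorem isFiniteMeasure_add_pointMass (μ : Measure ℝ) [IsFiniteMeasure μ] (η x₀ : ℝ) :
    IsFiniteMeasure (μ + (Real.toNNReal η) • Measure.dirac x₀) := by
  infer_instance

/-- The perturbed measure dominates `μ`. [folklore] -/
theorem le_add_pointMass (μ : Measure ℝ) (η x₀ : ℝ) : μ ≤ μ + (Real.toNNReal η) • Measure.dirac x₀ :=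
  Measure.le_add_right le_rfl

/-- If `μ` is carried by `(0, ∞)` and `x₀ > 0`, so is `μ + η δ_{x₀}`. [folklore] -/
theorem add_pointMass_Iic_zero (μ : Measure ℝ) (hμ : μ (Iic 0) = 0) (η : ℝ) {x₀ : ℝ} (hx₀ : 0 < x₀) :
    (μ + (Real.toNNReal η) • Measure.dirac x₀) (Iic 0) = 0 := by
  have hx : x₀ ∉ Iic (0 : ℝ) := by simpa using hx₀
  rw [Measure.add_apply, Measure.smul_apply, hμ, zero_add,
    (MeasureTheory.dirac_eq_zero_iff_not_mem measurableSet_Iic).2 hx, smul_zero]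

/-! ### Power moments never cap the inverse moment -/

/-- **Power moments never cap the inverse moment.** For every finite measure `μ` on `ℝ` with `x⁻¹ ∈ L¹(μ)` (e.g. any
finite atomic measure on `(0,∞)`, such as a current spectral measure `μ_𝒥`), every `ε > 0` and every `Λ : ℝ` there are
`0 < η ≤ ε` and `0 < x₀ ≤ 1` such that `ν = μ + η δ_{x₀}` has `|∫ x^k dν − ∫ x^k dμ| ≤ ε` for EVERY `k : ℕ` with `x^k ∈ L¹(μ)`
and `Λ ≤ ∫ x⁻¹ dν`. [folklore] -/
theorem exists_pointMass_moments_close_invMoment_ge (μ : Measure ℝ) [IsFiniteMeasure μ]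
    (hinv : Integrable (fun x : ℝ => x⁻¹) μ) {ε : ℝ} (hε : 0 < ε) (Λ : ℝ) :
    ∃ η x₀ : ℝ, 0 < η ∧ η ≤ ε ∧ 0 < x₀ ∧ x₀ ≤ 1 ∧
      (∀ k : ℕ, Integrable (fun x : ℝ => x ^ k) μ →
        |(∫ x, x ^ k ∂(μ + (Real.toNNReal η) • Measure.dirac x₀)) - ∫ x, x ^ k ∂μ| ≤ ε) ∧
      Λ ≤ ∫ x, x⁻¹ ∂(μ + (Real.toNNReal η) • Measure.dirac x₀) := by
  set I : ℝ := ∫ x, x⁻¹ ∂μ with hI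
  set D : ℝ := |Λ| + |I| + 1 with hD
  have hD0 : 0 < D := by positivity
  set x₀ : ℝ := min 1 (ε / D) with hx₀
  have hx₀pos : 0 < x₀ := lt_min one_pos (div_pos hε hD0)
  have hx₀le1 : x₀ ≤ 1 := min_le_left _ _
  have hx₀leD : x₀ ≤ ε / D := min_le_right _ _
  refine ⟨ε, x₀, hε, le_rfl, hx₀pos, hx₀le1, fun k hk => ?_, ?_⟩
  · rw [integral_add_pointMass μ hk hε.le x₀]
    have hpow : x₀ ^ k ≤ 1 := pow_le_one₀ hx₀pos.le hx₀le1
    have hpow0 : 0 ≤ x₀ ^ k := pow_nonneg hx₀pos.le k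
    rw [add_sub_cancel_left, abs_of_nonneg (mul_nonneg hε.le hpow0)]
    calc ε * x₀ ^ k ≤ ε * 1 := by gcongr
      _ = ε := mul_one ε
  · rw [integral_add_pointMass μ hinv hε.le x₀]
    -- `ε / x₀ ≥ D ≥ Λ − I`
    have hquot : D ≤ ε * x₀⁻¹ := by
      rw [← div_eq_mul_inv, le_div_iff₀ hx₀pos]
      calc D * x₀ ≤ D * (ε / D) := by gcongr
        _ = ε := mul_div_cancel₀ ε hD0.ne'
    have h1 : Λ ≤ |Λ| := le_abs_self Λ
    have h2 : -|I| ≤ I := neg_abs_le I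
    linarith

/-- **THE BARRIER: no finite family of strict moment windows forces the inverse moment down.** Let `μ` be a finite
measure on `ℝ` with `x⁻¹ ∈ L¹(μ)` whose power moments satisfy finitely many STRICT windows `lo k < ∫ x^k dμ < hi k`
(`k ∈ K`, `K` finite, each `x^k ∈ L¹(μ)`). Then for every `Λ` there is a finite measure `ν ≥ μ` — carried by `(0,∞)`
if `μ` is — whose moments satisfy the SAME windows on `K` and whose inverse moment is `≥ Λ`; consequently, for every
«kinetic» value `Kval` and every `ρ₀`, the Kohn value `Kval − ∫ x⁻¹ dν ≤ ρ₀`. Hence the largest lower bound on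
`K − M₋₁ = ρ_s L²` implied by such data is `−∞`: certified moment rows of non-zero width (any finite list, any level,
any energy window) can only ever give stiffness CEILINGS. [folklore] -/
theorem exists_invMoment_ge_in_strict_windows (μ : Measure ℝ) [IsFiniteMeasure μ]
    (hinv : Integrable (fun x : ℝ => x⁻¹) μ) (K : Finset ℕ) (lo hi : ℕ → ℝ)
    (hint : ∀ k ∈ K, Integrable (fun x : ℝ => x ^ k) μ)
    (hwin : ∀ k ∈ K, lo k < ∫ x, x ^ k ∂μ ∧ ∫ x, x ^ k ∂μ < hi k) (Λ Kval ρ₀ : ℝ) :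
    ∃ ν : Measure ℝ, IsFiniteMeasure ν ∧ μ ≤ ν ∧ (μ (Iic 0) = 0 → ν (Iic 0) = 0) ∧
      (∀ k ∈ K, lo k < ∫ x, x ^ k ∂ν ∧ ∫ x, x ^ k ∂ν < hi k) ∧
      Λ ≤ ∫ x, x⁻¹ ∂ν ∧ Kval - ∫ x, x⁻¹ ∂ν ≤ ρ₀ := by
  -- a common margin `ε > 0` strictly below every window slack
  set g : ℕ → ℝ := fun k => min ((∫ x, x ^ k ∂μ) - lo k) (hi k - ∫ x, x ^ k ∂μ) with hg
  have hgpos : ∀ k ∈ K, 0 < g k := fun k hk => lt_min (by linarith [(hwin k hk).1]) (by linarith [(hwin k hk).2])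
  obtain ⟨ε, hε, hεg⟩ : ∃ ε : ℝ, 0 < ε ∧ ∀ k ∈ K, ε < g k := by
    by_cases hK : K.Nonempty
    · obtain ⟨k₀, hk₀, hmin⟩ := K.exists_min_image g hK
      exact ⟨g k₀ / 2, by linarith [hgpos k₀ hk₀], fun k hk => by linarith [hmin k hk, hgpos k₀ hk₀]⟩
    · exact ⟨1, one_pos, fun k hk => (hK ⟨k, hk⟩).elim⟩
  obtain ⟨η, x₀, hη, -, hx₀, -, hmom, hΛ⟩ :=
    exists_pointMass_moments_close_invMoment_ge μ hinv hε (max Λ (Kval - ρ₀))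
  refine ⟨μ + (Real.toNNReal η) • Measure.dirac x₀, isFiniteMeasure_add_pointMass μ η x₀, le_add_pointMass μ η x₀,
    fun h0 => add_pointMass_Iic_zero μ h0 η hx₀, fun k hk => ?_, (le_max_left _ _).trans hΛ, ?_⟩
  · have h := hmom k (hint k hk)
    rw [abs_le] at h
    have h1 := hεg k hk
    have h2 : g k ≤ (∫ x, x ^ k ∂μ) - lo k := min_le_left _ _
    have h3 : g k ≤ hi k - ∫ x, x ^ k ∂μ := min_le_right _ _
    constructor <;> linarith [h.1, h.2]
  · have := (le_max_right _ _).trans hΛ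
    linarith

/-! ### Evasion (i): a current gap caps the inverse moment -/

/-- **Evasion (i) — a GAP below the current spectral weight gives a floor.** If the finite measure `ν` on `ℝ` is carried
by `[Δ, ∞)` with `Δ > 0` (`ν(−∞, Δ) = 0`), then `∫ x⁻¹ dν ≤ ν(ℝ)/Δ` (`= m₀/Δ`); with Kohn's formula this is the floor
`ρ_s L² ≥ K − m₀/Δ_𝒥`. Nothing in the programme certifies such a `Δ_𝒥` at `(U, n) = (8, 7/8)`. [folklore] -/
theorem invMoment_le_mass_div_of_gap (ν : Measure ℝ) [IsFiniteMeasure ν] {Δ : ℝ} (hΔ : 0 < Δ)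
    (hgap : ν (Iio Δ) = 0) : ∫ x, x⁻¹ ∂ν ≤ ν.real univ / Δ := by
  have hae : ∀ᵐ x ∂ν, Δ ≤ x := by
    have h := (measure_eq_zero_iff_ae_notMem (μ := ν) (s := Iio Δ)).1 hgap
    filter_upwards [h] with x hx
    simpa using hx
  have hle : (fun x : ℝ => x⁻¹) ≤ᵐ[ν] fun _ => Δ⁻¹ := by
    filter_upwards [hae] with x hx
    exact inv_anti₀ hΔ hx
  have hnn : 0 ≤ᵐ[ν] fun x : ℝ => x⁻¹ := by
    filter_upwards [hae] with x hx
    exact inv_nonneg.mpr (hΔ.le.trans hx)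
  calc ∫ x, x⁻¹ ∂ν ≤ ∫ _, Δ⁻¹ ∂ν := integral_mono_of_nonneg hnn (integrable_const _) hle
    _ = ν.real univ / Δ := by rw [integral_const, smul_eq_mul, div_eq_mul_inv]

/-- **Evasion (i), floor form.** Under a gap `Δ` below the current spectral weight, the Kohn value is bounded BELOW:
`K − m₀/Δ ≤ K − ∫ x⁻¹ dν`. [folklore] -/
theorem kohn_floor_of_gap (ν : Measure ℝ) [IsFiniteMeasure ν] {Δ : ℝ} (hΔ : 0 < Δ)
    (hgap : ν (Iio Δ) = 0) (Kval : ℝ) : Kval - ν.real univ / Δ ≤ Kval - ∫ x, x⁻¹ ∂ν := by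
  have := invMoment_le_mass_div_of_gap ν hΔ hgap
  linarith

/-! ### What finitely many moments DO give: the ceiling-side (Jensen / AM–GM) inequalities -/

/-- Optimising a two-term AM–GM family: if `2m ≤ t a + b/t` for every `t > 0` (`m, a, b ≥ 0`) then `m² ≤ a b`. [folklore] -/
theorem sq_le_mul_of_forall_two_mul_le {m a b : ℝ} (hm : 0 ≤ m) (ha : 0 ≤ a) (hb : 0 ≤ b)
    (h : ∀ t : ℝ, 0 < t → 2 * m ≤ t * a + b / t) : m ^ 2 ≤ a * b := by
  rcases hm.eq_or_lt with hm0 | hm0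
  · rw [← hm0]; simpa using mul_nonneg ha hb
  rcases hb.eq_or_lt with hb0 | hb0
  · -- `b = 0`: `2m ≤ t a` for all `t > 0` forces `m ≤ 0`
    exfalso
    have h1 := h (m / (a + 1)) (div_pos hm0 (by linarith))
    rw [← hb0, zero_div, add_zero] at h1
    have h2 : m / (a + 1) * a ≤ m := by
      rw [div_mul_eq_mul_div, div_le_iff₀ (by linarith : (0:ℝ) < a + 1)]; nlinarith
    linarith
  · have h1 := h (b / m) (div_pos hb0 hm0)
    have h2 : b / (b / m) = m := by field_simp
    rw [h2] at h1
    have h3 : m ≤ b / m * a := by linarith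
    rw [div_mul_eq_mul_div, le_div_iff₀ hm0] at h3
    nlinarith

/-- Pointwise AM–GM behind `m₀² ≤ m₋₁ m₁`: `2 ≤ t x⁻¹ + x/t` for `x, t > 0`. [folklore] -/
theorem two_le_mul_inv_add_div {x t : ℝ} (hx : 0 < x) (ht : 0 < t) : 2 ≤ t * x⁻¹ + x / t := by
  rw [← div_eq_mul_inv, div_add_div _ _ hx.ne' ht.ne', le_div_iff₀ (mul_pos hx ht)]
  nlinarith [sq_nonneg (t - x)]

/-- Pointwise AM–GM behind `m₁² ≤ m₋₁ m₃`: `2x ≤ t x⁻¹ + x³/t` for `x, t > 0`. [folklore] -/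
theorem two_mul_le_mul_inv_add_cube_div {x t : ℝ} (hx : 0 < x) (ht : 0 < t) :
    2 * x ≤ t * x⁻¹ + x ^ 3 / t := by
  rw [← div_eq_mul_inv, div_add_div _ _ hx.ne' ht.ne', le_div_iff₀ (mul_pos hx ht)]
  nlinarith [sq_nonneg (t - x ^ 2), hx]

/-- **Ceiling side, even form (Bohigas–Lane–Martorell / Pitaevskii–Stringari, the tree's T3):** for a finite measure `ν`
carried by `(0,∞)` with `x⁻¹, x ∈ L¹(ν)`, `ν(ℝ)² ≤ (∫ x⁻¹ dν)(∫ x dν)`, i.e. `m₀² ≤ M₋₁ m₁`, hence `M₋₁ ≥ m₀²/m₁` and the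
stiffness CEILING `ρ_s L² ≤ K − m₀²/m₁`. [cite: Lipparini2008, §8.4 eqs. (8.30)–(8.33)] -/
theorem sq_mass_le_invMoment_mul_firstMoment (ν : Measure ℝ) [IsFiniteMeasure ν] (hpos : ν (Iic 0) = 0)
    (hinv : Integrable (fun x : ℝ => x⁻¹) ν) (h1 : Integrable (fun x : ℝ => x) ν) :
    (ν.real univ) ^ 2 ≤ (∫ x, x⁻¹ ∂ν) * ∫ x, x ∂ν := by
  have hae : ∀ᵐ x ∂ν, 0 < x := by
    have h := (measure_eq_zero_iff_ae_notMem (μ := ν) (s := Iic 0)).1 hpos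
    filter_upwards [h] with x hx
    simpa using hx
  have hinv0 : 0 ≤ ∫ x, x⁻¹ ∂ν :=
    integral_nonneg_of_ae (by filter_upwards [hae] with x hx; exact inv_nonneg.mpr hx.le)
  have h10 : 0 ≤ ∫ x, x ∂ν := integral_nonneg_of_ae (by filter_upwards [hae] with x hx; exact hx.le)
  refine sq_le_mul_of_forall_two_mul_le measureReal_nonneg hinv0 h10 fun t ht => ?_
  have hle : (fun _ : ℝ => (2 : ℝ)) ≤ᵐ[ν] fun x => t * x⁻¹ + x / t := by
    filter_upwards [hae] with x hx
    exact two_le_mul_inv_add_div hx ht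
  have hint : Integrable (fun x : ℝ => t * x⁻¹ + x / t) ν := (hinv.const_mul t).add (h1.div_const t)
  have hmono := integral_mono_ae (integrable_const (2 : ℝ)) hint hle
  rw [integral_const, smul_eq_mul, integral_add (hinv.const_mul t) (h1.div_const t), integral_const_mul,
    integral_div] at hmono
  linarith

/-- **Ceiling side, odd form (the tree's R-K3-TL row):** for a finite measure `ν` carried by `(0,∞)` with
`x⁻¹, x, x³ ∈ L¹(ν)`, `(∫ x dν)² ≤ (∫ x⁻¹ dν)(∫ x³ dν)`, i.e. `m₁² ≤ M₋₁ m₃`, hence `M₋₁ ≥ m₁²/m₃` and the stiffness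
CEILING `ρ_s L² ≤ K − m₁²/m₃` from the two LOCAL odd moments. Together with `exists_invMoment_ge_in_strict_windows`:
finitely many moment windows bound `M₋₁` from BELOW (ceilings on `ρ_s`) and never from above. [cite: Lipparini2008, §8.4 eqs. (8.30)–(8.33)] -/
theorem sq_firstMoment_le_invMoment_mul_thirdMoment (ν : Measure ℝ) [IsFiniteMeasure ν] (hpos : ν (Iic 0) = 0)
    (hinv : Integrable (fun x : ℝ => x⁻¹) ν) (h1 : Integrable (fun x : ℝ => x) ν)
    (h3 : Integrable (fun x : ℝ => x ^ 3) ν) :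
    (∫ x, x ∂ν) ^ 2 ≤ (∫ x, x⁻¹ ∂ν) * ∫ x, x ^ 3 ∂ν := by
  have hae : ∀ᵐ x ∂ν, 0 < x := by
    have h := (measure_eq_zero_iff_ae_notMem (μ := ν) (s := Iic 0)).1 hpos
    filter_upwards [h] with x hx
    simpa using hx
  have hinv0 : 0 ≤ ∫ x, x⁻¹ ∂ν :=
    integral_nonneg_of_ae (by filter_upwards [hae] with x hx; exact inv_nonneg.mpr hx.le)
  have h10 : 0 ≤ ∫ x, x ∂ν := integral_nonneg_of_ae (by filter_upwards [hae] with x hx; exact hx.le)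
  have h30 : 0 ≤ ∫ x, x ^ 3 ∂ν :=
    integral_nonneg_of_ae (by filter_upwards [hae] with x hx; exact pow_nonneg hx.le 3)
  refine sq_le_mul_of_forall_two_mul_le h10 hinv0 h30 fun t ht => ?_
  have hle : (fun x : ℝ => 2 * x) ≤ᵐ[ν] fun x => t * x⁻¹ + x ^ 3 / t := by
    filter_upwards [hae] with x hx
    exact two_mul_le_mul_inv_add_cube_div hx ht
  have hint : Integrable (fun x : ℝ => t * x⁻¹ + x ^ 3 / t) ν := (hinv.const_mul t).add (h3.div_const t)
  have hmono := integral_mono_ae (h1.const_mul 2) hint hle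
  rw [integral_const_mul, integral_add (hinv.const_mul t) (h3.div_const t), integral_const_mul,
    integral_div] at hmono
  linarith

end Summit.Ventures.CertifiedManyBodySolver.Observables

end
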